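import Literature.Computability.AlgebraicComplexity.DIP20MultiplicityObstructions
import Literature.Computability.AlgebraicComplexity.ChowPlethysmBridge
import Literature.Computability.AlgebraicComplexity.PlethysmLifting
import HarnessLib

/-!
# Dörfler–Ikenmeyer–Panova 2020, Lemma 3.4, discharged: `mult_λ(ℂ[Ch_m^n]_d) ≤ a_λ(n[d])`

Topic `Literature/Computability/AlgebraicComplexity` (val-lit cell, DAG row DIP20-A; discharge of
the named fact `DIP20_lem_3_4` of `DIP20MultiplicityObstructions.lean`). Source: J. Dörfler,
C. Ikenmeyer, G. Panova, *On geometric complexity theory: Multiplicity obstructions are stronger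
than occurrence obstructions*, SIAM J. Appl. Algebra Geom. 4 (2020) = arXiv:1901.04576, Lemma 3.4
(arXiv p. 5; TeX multobs.tex L339 `lem:chowupperbound`): "Let `λ` be an `m`-partition and `n ≥ m`.
Then `mult_λ(ℂ[Ch_m^n]_d) ≤ a_λ(n[d])`."

## The proof formalised here (Hadamard–Howe instead of Peter–Weyl)

The printed proof goes through the coordinate ring of the ORBIT `GL_n · x₁⋯x_n = GL_n / H`,
`H = T ⋊ 𝔖_n`, the algebraic Peter–Weyl theorem and `dim {λ}^H = a_λ(n[d])` (Gay's theorem).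
The tree has no Peter–Weyl theorem; instead it has the Hermite–Hadamard–Howe machinery of
Bürgisser–Hüttenhain–Ikenmeyer 2017 / Landsberg (files `ChowPullback.lean`, `ChowSymmetric.lean`,
`ChowNormalization.lean`, `ChowPlethysmBridge.lean`), which gives the same inequality directly
(Landsberg, arXiv:1305.7387, §7.2, Prop. 7.4: `ker h_{d,n} = I_d(Ch_n(W^*))`, so
`ℂ[Ch_n]_d ↪ S^n(S^d W)`):

* the pullback `φ_n^* : k[Sym^n k^n] → k[Mat_n]`, `F ↦ F(ℓ_0 ⋯ ℓ_{n-1})` (`chowPullback n`) is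
  `GL_n`-equivariant (`chowPullbackIntertwining`), kills exactly the vanishing ideal of the orbit
  `GL_n · x₀⋯x_{n-1}` (`chowPullback_ne_zero_iff`), and maps forms of degree `d` into the balanced
  form-symmetric polynomials `𝒪(V^n // H_n)_d = Sym^n Sym^d V^*` (`chowPullback_mem_symBalanced_of_isHomogeneous`);
* the PROVED equivariant isomorphism `Ξ : 𝒪(V^n // H_n)_d ≅ k[Sym^d k^n]_n` (`plethysmRestitution`,
  left inverse `plethysmBridge`, `plethysmRestitution_mem_highestWeightSpace`);
* rank–nullity on highest-weight vectors (`orbitMultiplicity_add_finrank_inf_eq_plethysmCoeff`,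
  Dörfler–Ikenmeyer–Panova (2.2)/§5).

Hence, for every weight `χ` of `GL_n` of size `-n·d` (`n, d ≥ 1`, characteristic zero),
`mult_χ k[Δ_n[x₀⋯x_{n-1}]] ≤ a_χ(n[d]) := dim HWV_χ(k[Sym^d k^n])`
(`orbitMultiplicity_prod_X_le_plethysmCoeff`), and DIP's Lemma 3.4 follows by the tree's few-letter
identity `mult_λ(ℂ[Ch_m^n]_d) = mult_λ(ℂ[Δ_n[x₁⋯x_n]]_d)` (`coordRingMultiplicity_chowSet_dualOfPartition`,
the first half of the printed proof) and the independence of `a_λ(n[d])` of the number `m ≥ ℓ(λ)`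
of variables (`plethysmCoeffOfPartition_eq_of_card_parts_le`).

HONEST FRAMING. A toy-model upper bound (Chow variety versus plethysm coefficients); nothing here
bears on permanent versus determinant; VP ≠ VNP is not proved and nothing in this file is progress
on it. No new definitions, no new named facts.

## References

* [DorflerIkenmeyerPanova2020] Lemma 3.4 (arXiv p. 5).
* [BurgisserHuttenhainIkenmeyer2017] P. Bürgisser, J. Hüttenhain, C. Ikenmeyer, *Permanent versus
  determinant: not via saturations*, Proc. AMS 145 (2017), §3.
* J. M. Landsberg, *Geometric complexity theory: an introduction for geometers*, Ann. Univ.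
  Ferrara 61 (2015) = arXiv:1305.7387, §7.2 Prop. 7.4 (Hadamard), §9.2.3.
-/

noncomputable section

open MvPolynomial

namespace Literature.Computability.AlgebraicComplexity

open _root_.Literature.NumberTheory.DiophantineGeometry

section Restitution

variable {k : Type*} [Field k] (N δ : ℕ)

/-- The restitution `Ξ : k[Mat_N] → k[Sym^δ k^N]` of `ChowPlethysmBridge.lean` is additive (a finite
sum of coefficient functionals times fixed monomials). [cite: BurgisserHuttenhainIkenmeyer2017, §3 (Lemma 4 and (5))] -/
theorem plethysmRestitution_add (G H : MvPolynomial (Fin N × Fin N) k) :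
    plethysmRestitution N δ (G + H) = plethysmRestitution N δ G + plethysmRestitution N δ H := by
  unfold plethysmRestitution
  rw [← Finset.sum_add_distrib]
  refine Finset.sum_congr rfl fun J _ => ?_
  rw [coeff_add, add_div, map_add, add_mul]

/-- The restitution `Ξ` is homogeneous: `Ξ(c G) = c Ξ(G)`. [cite: BurgisserHuttenhainIkenmeyer2017, §3 (Lemma 4 and (5))] -/
theorem plethysmRestitution_smul (c : k) (G : MvPolynomial (Fin N × Fin N) k) :
    plethysmRestitution N δ (c • G) = c • plethysmRestitution N δ G := by
  unfold plethysmRestitution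
  rw [Finset.smul_sum]
  refine Finset.sum_congr rfl fun J _ => ?_
  rw [coeff_smul, smul_eq_mul, mul_div_assoc, map_mul, mul_assoc, smul_eq_C_mul]

end Restitution

section Core

variable {k : Type*} [Field k]

/-- The pullback of a highest-weight vector of weight `χ` of size `-n·d` (a form of degree `d`) is a
balanced form-symmetric polynomial of degree `d` (BHI: "`ψ_n^*` is a homomorphism of graded algebras").
[cite: BurgisserHuttenhainIkenmeyer2017, §3 (proof of Prop. 2: the grading of ψ_n^*)] -/
theorem chowPullback_mem_symBalanced_of_mem_highestWeightSpace [CharZero k] {n d : ℕ} (hn : n ≠ 0)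
    {χ : Weight (Fin n)} (hχ : χ.size = -((n * d : ℕ) : ℤ)) {F : MvPolynomial (DegIdx (Fin n) n) k}
    (hF : F ∈ highestWeightSpace (coordRep (Fin n) k n) χ) :
    chowPullback n F ∈ symBalanced (k := k) n d :=
  haveI : Infinite k := CharZero.infinite k
  chowPullback_mem_symBalanced_of_isHomogeneous n (isHomogeneous_of_mem_highestWeightSpace hn hF hχ)

/-- The pullback of a highest-weight vector is a highest-weight vector for `formsRep`
(equivariance of `φ_n^*`, BHI: "`φ_n` is `G`-equivariant"). [cite: BurgisserHuttenhainIkenmeyer2017, §3 (φ_n is G-equivariant)] -/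
theorem chowPullback_mem_highestWeightSpace_formsRep [CharZero k] {n : ℕ} {χ : Weight (Fin n)}
    {F : MvPolynomial (DegIdx (Fin n) n) k} (hF : F ∈ highestWeightSpace (coordRep (Fin n) k n) χ) :
    chowPullback n F ∈ highestWeightSpace (formsRep n) χ :=
  haveI : Infinite k := CharZero.infinite k
  highestWeightSpace_le_comap_intertwiningMap (chowPullbackIntertwining (k := k) n) χ hF

/-- `Ξ(φ_n^*(F))` is a highest-weight vector of `k[Sym^d k^n]` of the same weight, for `F` a
highest-weight vector of `k[Sym^n k^n]` of weight of size `-n·d` (the Hadamard–Howe map on highest-weight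
vectors; proof of DIP Lemma 3.4 in the tree's rendering). [cite: DorflerIkenmeyerPanova2020, Lemma 3.4 (proof, arXiv p. 5)] -/
theorem plethysmRestitution_chowPullback_mem [CharZero k] {n d : ℕ} (hn : n ≠ 0)
    {χ : Weight (Fin n)} (hχ : χ.size = -((n * d : ℕ) : ℤ)) {F : MvPolynomial (DegIdx (Fin n) n) k}
    (hF : F ∈ highestWeightSpace (coordRep (Fin n) k n) χ) :
    plethysmRestitution n d (chowPullback n F) ∈ highestWeightSpace (coordRep (Fin n) k d) χ :=
  plethysmRestitution_mem_highestWeightSpace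
    (chowPullback_mem_symBalanced_of_mem_highestWeightSpace hn hχ hF)
    (chowPullback_mem_highestWeightSpace_formsRep hF)

/-- If `Ξ(φ_n^*(F)) = 0` for a highest-weight vector `F` of weight of size `-n·d`, then `F`
vanishes on the orbit `GL_n · x₀⋯x_{n-1}` (`Ξ` is injective on `𝒪(V^n // H_n)_d` and
`ker φ_n^* = I(GL_n · x₀⋯x_{n-1})`; Hadamard: `ker h_{d,n} = I_d(Ch_n)`).
[cite: DorflerIkenmeyerPanova2020, Lemma 3.4 (proof, arXiv p. 5)] -/
theorem mem_orbitVanishingIdeal_of_plethysmRestitution_chowPullback_eq_zero [CharZero k] {n d : ℕ}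
    (hn : n ≠ 0) {χ : Weight (Fin n)} (hχ : χ.size = -((n * d : ℕ) : ℤ))
    {F : MvPolynomial (DegIdx (Fin n) n) k} (hF : F ∈ highestWeightSpace (coordRep (Fin n) k n) χ)
    (h0 : plethysmRestitution n d (chowPullback n F) = 0) :
    F ∈ orbitVanishingIdeal (∏ i : Fin n, X i : MvPolynomial (Fin n) k) n := by
  haveI : Infinite k := CharZero.infinite k
  have h1 : chowPullback n F = 0 := by
    rw [← plethysmBridge_plethysmRestitution
      (chowPullback_mem_symBalanced_of_mem_highestWeightSpace hn hχ hF), h0, plethysmBridge_zero]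
  by_contra hI
  exact ((chowPullback_ne_zero_iff n).mpr hI) h1

/-- **The Hadamard–Howe upper bound for the Chow orbit closure** (Landsberg, arXiv:1305.7387,
Prop. 7.4: `ℂ[Ch_n]_d = S^d(S^n W)/ker h_{d,n} ↪ S^n(S^d W)`; the `m = n` case of
Dörfler–Ikenmeyer–Panova 2020 Lemma 3.4, in weight form): over a field of characteristic zero, for
`n, d ≥ 1` and a weight `χ` of `GL_n` of size `-n·d`,
`mult_χ k[Δ_n[x₀⋯x_{n-1}]] ≤ dim HWV_χ(k[Sym^d k^n]) = a_χ(n[d])`.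
Proof: the pullback along products of linear forms restricted to `HWV_χ(k[Sym^n k^n])` has kernel
inside the vanishing ideal of the orbit and image inside the highest-weight vectors of
`𝒪(V^n // H_n)_d`, which the restitution `Ξ` embeds into `HWV_χ(k[Sym^d k^n])`; rank–nullity.
[cite: DorflerIkenmeyerPanova2020, Lemma 3.4 (arXiv p. 5)] -/
theorem orbitMultiplicity_prod_X_le_plethysmCoeff [CharZero k] {n d : ℕ} (hn : n ≠ 0) (hd : d ≠ 0)
    {χ : Weight (Fin n)} (hχ : χ.size = -((n * d : ℕ) : ℤ)) :
    orbitMultiplicity k (∏ i : Fin n, X i : MvPolynomial (Fin n) k) n χ ≤ plethysmCoeff k (Fin n) d χ := by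
  classical
  haveI : Infinite k := CharZero.infinite k
  haveI : FiniteDimensional k ↥(highestWeightSpace (coordRep (Fin n) k n) χ) :=
    finiteDimensional_highestWeightSpace_coordRep_holds hn χ
  haveI : FiniteDimensional k ↥(highestWeightSpace (coordRep (Fin n) k d) χ) :=
    finiteDimensional_highestWeightSpace_coordRep_holds hd χ
  -- the composite `Ξ ∘ φ_n^*`, restricted to `HWV_χ(k[Sym^n k^n])` and corestricted to `HWV_χ(k[Sym^d k^n])`
  let L₀ : MvPolynomial (DegIdx (Fin n) n) k →ₗ[k] MvPolynomial (DegIdx (Fin n) d) k :=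
    { toFun := fun F => plethysmRestitution n d (chowPullback n F)
      map_add' := fun F G => by simp only [map_add, plethysmRestitution_add]
      map_smul' := fun c F => by simp only [map_smul, plethysmRestitution_smul, RingHom.id_apply] }
  have hL₀ : ∀ F, L₀ F = plethysmRestitution n d (chowPullback n F) := fun F => rfl
  let L₁ := L₀.domRestrict (highestWeightSpace (coordRep (Fin n) k n) χ)
  have hL₁ : ∀ F : ↥(highestWeightSpace (coordRep (Fin n) k n) χ),
      L₁ F ∈ highestWeightSpace (coordRep (Fin n) k d) χ := fun F => by
    rw [LinearMap.domRestrict_apply, hL₀]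
    exact plethysmRestitution_chowPullback_mem hn hχ F.2
  let L := L₁.codRestrict (highestWeightSpace (coordRep (Fin n) k d) χ) hL₁
  -- its kernel lies in the vanishing ideal of the orbit
  have hker : LinearMap.ker L ≤
      (highestWeightSpace (coordRep (Fin n) k n) χ ⊓
        (orbitVanishingIdeal (∏ i : Fin n, X i : MvPolynomial (Fin n) k) n).restrictScalars k).comap
        (highestWeightSpace (coordRep (Fin n) k n) χ).subtype := by
    intro F hF
    rw [LinearMap.mem_ker] at hF
    have h0 : plethysmRestitution n d (chowPullback n (F : MvPolynomial _ k)) = 0 := by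
      rw [← hL₀, ← LinearMap.domRestrict_apply _ _ F]
      exact congrArg Subtype.val hF
    exact ⟨F.2, mem_orbitVanishingIdeal_of_plethysmRestitution_chowPullback_eq_zero hn hχ F.2 h0⟩
  -- dimension count
  have hrn := LinearMap.finrank_range_add_finrank_ker L
  have hkerle : Module.finrank k ↥(LinearMap.ker L) ≤
      Module.finrank k ↥(highestWeightSpace (coordRep (Fin n) k n) χ ⊓
        (orbitVanishingIdeal (∏ i : Fin n, X i : MvPolynomial (Fin n) k) n).restrictScalars k) := by
    rw [← (Submodule.comapSubtypeEquivOfLe (inf_le_left :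
      highestWeightSpace (coordRep (Fin n) k n) χ ⊓
        (orbitVanishingIdeal (∏ i : Fin n, X i : MvPolynomial (Fin n) k) n).restrictScalars k ≤ _)).finrank_eq]
    exact Submodule.finrank_mono hker
  have hrange : Module.finrank k ↥(LinearMap.range L) ≤ plethysmCoeff k (Fin n) d χ :=
    Submodule.finrank_le _
  have hmult := orbitMultiplicity_add_finrank_inf_eq_plethysmCoeff
    (∏ i : Fin n, X i : MvPolynomial (Fin n) k) hn χ
  have hWdim : Module.finrank k ↥(highestWeightSpace (coordRep (Fin n) k n) χ) =
      plethysmCoeff k (Fin n) n χ := rfl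
  omega

/-- **Partition form** of the Hadamard–Howe bound (Dörfler–Ikenmeyer–Panova 2020, Lemma 3.4 at
`m = n`): for `n, d ≥ 1` and `λ ⊢ d·n` with at most `n` parts,
`mult_{λ^*} k[Δ_n[x₀⋯x_{n-1}]] ≤ a_λ(n[d]) = plethysmCoeffOfPartition k n d λ`.
[cite: DorflerIkenmeyerPanova2020, Lemma 3.4 (arXiv p. 5)] -/
theorem orbitMultiplicity_prod_X_dualOfPartition_le [CharZero k] {n d : ℕ} (hn : n ≠ 0)
    (hd : d ≠ 0) (lam : Nat.Partition (d * n)) (hlam : lam.parts.card ≤ n) :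
    orbitMultiplicity k (∏ i : Fin n, X i : MvPolynomial (Fin n) k) n (Weight.dualOfPartition n lam) ≤
      plethysmCoeffOfPartition k n d lam := by
  refine orbitMultiplicity_prod_X_le_plethysmCoeff hn hd ?_
  rw [Weight.dualOfPartition, Weight.size_dual, Weight.size_ofPartition_holds hlam, Nat.mul_comm]

/-- The truncated Chow monomial with all `n` variables is `x₀ ⋯ x_{n-1}`. [folklore] -/
private theorem truncatedChowMonomial_self (n : ℕ) :
    truncatedChowMonomial k n n le_rfl = ∏ i : Fin n, X i := by
  unfold truncatedChowMonomial
  simp only [Fin.castLE_rfl, id_eq]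

end Core

section Junk

variable {k : Type*} [Field k]

/-- Junk case `n = 0` of the numeric multiplicity: `GL_0` is trivial, so every polynomial in the
single coordinate of `Sym^0 k^0` is a highest-weight vector, the highest-weight space is
infinite-dimensional and the `finrank`-valued plethysm coefficient is `0`. [folklore] -/
private theorem plethysmCoeff_fin_zero_zero (χ : Weight (Fin 0)) : plethysmCoeff k (Fin 0) 0 χ = 0 := by
  classical
  have htop : highestWeightSpace (coordRep (Fin 0) k 0) χ = ⊤ := by
    rw [eq_top_iff]
    intro F _ g _
    have hg : g = 1 := Units.ext (Subsingleton.elim _ _)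
    subst hg
    rw [map_one, weightChar_one, one_smul]
    rfl
  unfold plethysmCoeff hwMultiplicity
  rw [htop, finrank_top]
  apply Module.finrank_of_not_finite
  intro hfin
  have hfinite := Module.Finite.finite_basis (MvPolynomial.basisMonomials (DegIdx (Fin 0) 0) k)
  haveI : Nonempty (DegIdx (Fin 0) 0) := ⟨⟨0, mem_degMonomials_iff.mpr rfl⟩⟩
  exact not_finite (DegIdx (Fin 0) 0 →₀ ℕ)

end Junk

/-- **Dörfler–Ikenmeyer–Panova 2020, Lemma 3.4, DISCHARGED** (arXiv p. 5; TeX multobs.tex L339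
`lem:chowupperbound`): "Let `λ` be an `m`-partition and `n ≥ m`. Then
`mult_λ(ℂ[Ch_m^n]_d) ≤ a_λ(n[d])`", as typed (`DIP20_lem_3_4`, inner degree `d ≥ 1`). Proof: the
few-letter identity `mult_λ(ℂ[Ch_m^n]_d) = mult_λ(ℂ[Δ_n[x₁⋯x_n]]_d)`
(`coordRingMultiplicity_chowSet_dualOfPartition`, the first half of the printed proof), the
Hadamard–Howe bound `orbitMultiplicity_prod_X_dualOfPartition_le` (in place of the printed
Peter–Weyl argument), and `a_λ(n[d])` being independent of the number `m ≥ ℓ(λ)` of variables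
(`plethysmCoeffOfPartition_eq_of_card_parts_le`). The degenerate case `n = 0` (then `m = 0`) is
the `finrank` junk `0 ≤ _`. [cite: DorflerIkenmeyerPanova2020, Lemma 3.4 (arXiv p. 5)] -/
theorem DIP20_lem_3_4_holds : DIP20_lem_3_4 := by
  intro m n d hmn hd lam hlam
  haveI : Infinite ℂ := CharZero.infinite ℂ
  rcases Nat.eq_zero_or_pos n with rfl | hn
  · obtain rfl : m = 0 := Nat.le_zero.mp hmn
    exact (coordRingMultiplicity_le_plethysmCoeff _ _ _).trans
      ((plethysmCoeff_fin_zero_zero _).le.trans (Nat.zero_le _))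
  · rw [coordRingMultiplicity_chowSet_dualOfPartition hmn le_rfl hn.ne' lam hlam,
      plethysmCoeffOfPartition_eq_of_card_parts_le hmn d lam hlam |>.symm, truncatedChowMonomial_self]
    exact orbitMultiplicity_prod_X_dualOfPartition_le hn.ne' hd.ne' lam (hlam.trans hmn)

end Literature.Computability.AlgebraicComplexity
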